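import Summits.KontsevichZagierPeriods.KontsevichZagierPeriods.Theorems.RootDecompRationalCubeDichotomySimpleBranchResidue

/-!
# Route RootDecompRationalCubeDichotomy — item 27842 `PiRationalisationSimpleBranch` PROVED, part 7/11 (`RootDecompRationalCubeDichotomySimpleBranchStatements`)

Theorems-split (≤ 400 lines each, sequential imports) of the decomp-kz lens-2 gen-4 file
`run/shared/lean/pub/decomp-kz/decomp-kz-lens-2/g4/PiRationalisationSimpleBranch27842.lean` (2963 lines; lens farm rc 0, writer re-check
rc 0 audit proof-of-item closed:true, critic g2 by-name probe std axioms, 2026-08-30T05:27:57Z/06:02:52Z). The rung: for simple-branch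
Nash data (`F(x,g) = 0`, `∂_z F(x,g) ≠ 0` on the closed cube) `[π]^K·[s] ∈ relations ⊔ ⟨rational closed-cube sector⟩` for all `K ≥ 1` —
root isolation on rational sub-boxes, the Green band move (planar Stokes inside the four moves), the half winding number ≡ 4[A] ≡ [π],
box rescaling, and `PiTimesSector` (item 26388, landed). The final part closes the ROUTE ITEM by name
(`piRationalisationSimpleBranch_proof`). Sector lemmas are REUSED from the landed rung-24903 file `…PiRationalisationSqrtMoves`.
[Kontsevich–Zagier 2001 §1.2; argument principle] Standard axioms, 0 sorry.
-/

noncomputable section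

set_option linter.dupNamespace false

namespace Summit.KontsevichZagierPeriods.RootDecompRationalCubeDichotomy.Rung27842.SimpleBranch

open MeasureTheory Set MvPolynomial
open Literature.NumberTheory.Transcendental Literature.NumberTheory.Transcendental.KZ
open Literature.ModelTheory.ExponentialFields (IsSemialgebraic)
open Summit.KontsevichZagierPeriods.KontsevichZagierPeriods.Theses.RootDecompRationalCubeDichotomy
  (PiTimesSector PiRationalisationSimpleBranch)
open Summit.KontsevichZagierPeriods.RootDecompRationalCubeDichotomy.Rung27842.RootIso

/-! ### The rational closed-cube sector and `[π]`-iteration on `relations ⊔ ⟨sector⟩`: REUSED from the landed rung-24903 file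
(`ratCubeSet`, `Rung24903.piRep_mul_mem_sup_of_mem_closure`, `Rung24903.piRep_mul_mem_sup`, `Rung24903.piIter_mem_sup`) -/

open Summit.KontsevichZagierPeriods.RootDecompRationalCubeDichotomy.Rung24903
  (piRep_mul_mem_sup_of_mem_closure piRep_mul_mem_sup piIter_mem_sup)

/-! ### The rung = ROUTE ITEM 27842 `…Theses.RootDecompRationalCubeDichotomy.PiRationalisationSimpleBranch` (by name) -/

/-! ### Isolation data and the intermediate statements -/

/-- Intermediate statement A (root isolation + subdivision). -/
def RootIsolation : Prop :=
  ∀ (n : ℕ) (g : (Fin n → ℝ) → ℝ) (U : Set (Fin n → ℝ)) (s : IntegralRep n)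
    (F : MvPolynomial (Fin (n + 1)) ℚ),
    IsOpen U → Set.pi Set.univ (fun _ : Fin n => Set.Icc (0:ℝ) 1) ⊆ U →
    IsSemialgebraicFunOn ℚ U g → AnalyticOnNhd ℝ g U →
    (∀ x ∈ Set.pi Set.univ (fun _ : Fin n => Set.Icc (0:ℝ) 1),
      aeval (Fin.snoc x (g x) : Fin (n + 1) → ℝ) F = 0) →
    (∀ x ∈ Set.pi Set.univ (fun _ : Fin n => Set.Icc (0:ℝ) 1),
      aeval (Fin.snoc x (g x) : Fin (n + 1) → ℝ) (pderiv (Fin.last n) F) ≠ 0) →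
    s.domain = Set.pi Set.univ (fun _ : Fin n => Set.Icc (0:ℝ) 1) →
    (∀ z ∈ Set.pi Set.univ (fun _ : Fin n => Set.Icc (0:ℝ) 1), s.integrand z = g z) →
    ∃ (k : ℕ) (lo hi : Fin k → Fin n → ℚ) (piece : Fin k → IntegralRep n) (a b c ε : Fin k → ℚ),
      (∀ j i, lo j i < hi j i) ∧
      (∀ j, (piece j).domain = Set.pi Set.univ (fun i : Fin n => Set.Icc ((lo j i : ℚ) : ℝ) (hi j i))) ∧
      (∀ j, (piece j).domain ⊆ Set.pi Set.univ (fun _ : Fin n => Set.Icc (0:ℝ) 1)) ∧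
      (∀ j, ∀ z ∈ (piece j).domain, (piece j).integrand z = g z) ∧
      of s - ∑ j, of (piece j) ∈ relations ∧
      (∀ j, (a j < b j ∧ 0 < ε j ∧ ε j < c j ∧ (∀ x ∈ (piece j).domain, ((a j : ℚ) : ℝ) + ((ε j : ℚ) : ℝ) < g x ∧ g x + ((ε j : ℚ) : ℝ) < ((b j : ℚ) : ℝ)) ∧ (∀ x ∈ (piece j).domain, ∀ z : ℂ, ((a j : ℚ) : ℝ) ≤ z.re → z.re ≤ ((b j : ℚ) : ℝ) → |z.im| ≤ ((c j : ℚ) : ℝ) → aeval (Fin.snoc (fun i => ((x i : ℝ) : ℂ)) z : Fin (n + 1) → ℂ) F = 0 → z = ((g x : ℝ) : ℂ))))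

/-- Intermediate statement B (the per-box chain, load-bearing). -/
def BoxChain : Prop :=
  ∀ (n : ℕ) (g : (Fin n → ℝ) → ℝ) (U : Set (Fin n → ℝ)) (piece : IntegralRep n)
    (F : MvPolynomial (Fin (n + 1)) ℚ) (lo hi : Fin n → ℚ) (a b c ε : ℚ),
    IsOpen U → piece.domain ⊆ U → IsSemialgebraicFunOn ℚ U g → AnalyticOnNhd ℝ g U →
    (∀ i, lo i < hi i) →
    piece.domain = Set.pi Set.univ (fun i : Fin n => Set.Icc ((lo i : ℚ) : ℝ) (hi i)) →
    (∀ z ∈ piece.domain, piece.integrand z = g z) →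
    (∀ x ∈ piece.domain, aeval (Fin.snoc x (g x) : Fin (n + 1) → ℝ) F = 0) →
    (∀ x ∈ piece.domain, aeval (Fin.snoc x (g x) : Fin (n + 1) → ℝ) (pderiv (Fin.last n) F) ≠ 0) →
    (a < b ∧ 0 < ε ∧ ε < c ∧ (∀ x ∈ piece.domain, ((a : ℚ) : ℝ) + ((ε : ℚ) : ℝ) < g x ∧ g x + ((ε : ℚ) : ℝ) < ((b : ℚ) : ℝ)) ∧ (∀ x ∈ piece.domain, ∀ z : ℂ, ((a : ℚ) : ℝ) ≤ z.re → z.re ≤ ((b : ℚ) : ℝ) → |z.im| ≤ ((c : ℚ) : ℝ) → aeval (Fin.snoc (fun i => ((x i : ℝ) : ℂ)) z : Fin (n + 1) → ℂ) F = 0 → z = ((g x : ℝ) : ℂ))) →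
    of piRep * of piece ∈ relations ⊔ AddSubgroup.closure ratCubeSet

/-! ### Statement A PROVED -/

/-- Rational closed boxes are `ℚ`-semialgebraic. [folklore] -/
theorem isSemialgebraic_ratBox {n : ℕ} (lo hi : Fin n → ℚ) :
    IsSemialgebraic ℚ (Set.pi Set.univ (fun i : Fin n => Icc ((lo i : ℚ) : ℝ) (hi i))) := by
  have hset : Set.pi Set.univ (fun i : Fin n => Icc ((lo i : ℚ) : ℝ) (hi i)) =
      ⋂ i ∈ (Finset.univ : Finset (Fin n)),
        ({x : Fin n → ℝ | MvPolynomial.aeval x (MvPolynomial.C (lo i) : MvPolynomial (Fin n) ℚ) ≤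
            MvPolynomial.aeval x (MvPolynomial.X i : MvPolynomial (Fin n) ℚ)} ∩
          {x : Fin n → ℝ | MvPolynomial.aeval x (MvPolynomial.X i : MvPolynomial (Fin n) ℚ) ≤
            MvPolynomial.aeval x (MvPolynomial.C (hi i) : MvPolynomial (Fin n) ℚ)}) := by
    ext x
    simp [Pi.le_def, forall_and]
  rw [hset]
  exact Literature.ModelTheory.ExponentialFields.IsSemialgebraic.biInter _ _ fun i _ =>
    (Literature.ModelTheory.ExponentialFields.isSemialgebraic_setOf_eval_le _ _).inter
      (Literature.ModelTheory.ExponentialFields.isSemialgebraic_setOf_eval_le _ _)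

/-- **Statement A PROVED**: uniform root isolation on a rational grid of sub-boxes + domain additivity. -/
theorem rootIsolation_holds : RootIsolation := by
  intro n g U s F hU hcU hsa hga hF0 hFz hsd hsg
  have hgc : ContinuousOn g U := hga.continuousOn
  obtain ⟨δ, hδ, hiso⟩ := uniform_root_isolation hU hcU g hgc F hF0 hFz
  have hcubec : IsCompact (Set.pi Set.univ (fun _ : Fin n => Set.Icc (0:ℝ) 1)) :=
    isCompact_univ_pi fun _ => isCompact_Icc
  have huc : UniformContinuousOn g (Set.pi Set.univ (fun _ : Fin n => Set.Icc (0:ℝ) 1)) :=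
    hcubec.uniformContinuousOn_of_continuous (hgc.mono hcU)
  obtain ⟨ρ, hρ, hρg⟩ := Metric.uniformContinuousOn_iff.1 huc (δ / 8) (by positivity)
  obtain ⟨N, hN⟩ := exists_nat_gt (1 / ρ)
  have hNpos : (0:ℝ) < N := lt_trans (by positivity) hN
  have hN0 : 0 < N := by exact_mod_cast hNpos
  have hmesh : (1:ℝ) / N < ρ := by
    rw [div_lt_iff₀ hNpos]
    calc (1:ℝ) = (1 / ρ) * ρ := by field_simp
      _ < N * ρ := mul_lt_mul_of_pos_right hN hρ
      _ = ρ * N := mul_comm _ _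
  -- the grid of `Nⁿ` rational boxes
  let lo : (Fin n → Fin N) → Fin n → ℚ := fun κ i => ((κ i : ℕ) : ℚ) / N
  let hi : (Fin n → Fin N) → Fin n → ℚ := fun κ i => (((κ i : ℕ) : ℚ) + 1) / N
  let box : (Fin n → Fin N) → Set (Fin n → ℝ) := fun κ =>
    Set.pi Set.univ (fun i : Fin n => Icc ((lo κ i : ℚ) : ℝ) (hi κ i))
  have hlo : ∀ κ i, ((lo κ i : ℚ) : ℝ) = ((κ i : ℕ) : ℝ) / (N : ℝ) := by intro κ i; simp [lo]
  have hhi : ∀ κ i, ((hi κ i : ℚ) : ℝ) = (((κ i : ℕ) : ℝ) + 1) / (N : ℝ) := by intro κ i; simp [hi]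
  have hlohi : ∀ κ i, lo κ i < hi κ i := by
    intro κ i
    exact div_lt_div_of_pos_right (by linarith) (by exact_mod_cast hN0)
  have hbox_cube : ∀ κ, box κ ⊆ Set.pi Set.univ (fun _ : Fin n => Set.Icc (0:ℝ) 1) := by
    intro κ x hx
    rw [Set.mem_univ_pi] at hx ⊢
    intro i
    have hxi := hx i
    rw [Set.mem_Icc, hlo, hhi] at hxi
    refine ⟨le_trans (by positivity) hxi.1, le_trans hxi.2 ?_⟩
    rw [div_le_one hNpos]
    have h := (κ i).isLt
    exact_mod_cast Nat.succ_le_of_lt h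
  have hdist : ∀ κ, ∀ x ∈ box κ, ∀ y ∈ box κ, dist x y < ρ := by
    intro κ x hx y hy
    refine lt_of_le_of_lt ?_ hmesh
    refine (dist_pi_le_iff (by positivity)).2 fun i => ?_
    rw [Set.mem_univ_pi] at hx hy
    have hxi := hx i
    have hyi := hy i
    rw [hlo, hhi] at hxi hyi
    refine (Real.dist_le_of_mem_Icc hxi hyi).trans (le_of_eq ?_)
    field_simp
    ring
  have hosc : ∀ κ, ∀ x ∈ box κ, ∀ y ∈ box κ, |g x - g y| < δ / 8 := by
    intro κ x hx y hy
    have := hρg x (hbox_cube κ hx) y (hbox_cube κ hy) (hdist κ x hx y hy)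
    rwa [Real.dist_eq] at this
  -- every point of the cube lies in a grid box
  have hcover : ∀ x ∈ Set.pi Set.univ (fun _ : Fin n => Set.Icc (0:ℝ) 1), ∃ κ, x ∈ box κ := by
    intro x hx
    rw [Set.mem_univ_pi] at hx
    refine ⟨fun i => ⟨min ⌊(N:ℝ) * x i⌋₊ (N - 1), by omega⟩, ?_⟩
    rw [Set.mem_univ_pi]
    intro i
    have hx0 : 0 ≤ x i := (hx i).1
    have hx1 : x i ≤ 1 := (hx i).2
    have hfl : (⌊(N:ℝ) * x i⌋₊ : ℝ) ≤ N * x i := Nat.floor_le (by positivity)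
    have hfl' : (N:ℝ) * x i < ⌊(N:ℝ) * x i⌋₊ + 1 := Nat.lt_floor_add_one _
    have hcomm : x i * (N:ℝ) = N * x i := mul_comm _ _
    simp only [Set.mem_Icc, hlo, hhi]
    constructor
    · rw [div_le_iff₀ hNpos]
      have hmin : ((min ⌊(N:ℝ) * x i⌋₊ (N - 1) : ℕ) : ℝ) ≤ ⌊(N:ℝ) * x i⌋₊ := by
        exact_mod_cast min_le_left _ _
      linarith
    · rw [le_div_iff₀ hNpos]
      by_cases hc : ⌊(N:ℝ) * x i⌋₊ ≤ N - 1
      · have hmin : ((min ⌊(N:ℝ) * x i⌋₊ (N - 1) : ℕ) : ℝ) = ⌊(N:ℝ) * x i⌋₊ := by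
          rw [min_eq_left hc]
        rw [hmin]
        linarith
      · push Not at hc
        have hmin : ((min ⌊(N:ℝ) * x i⌋₊ (N - 1) : ℕ) : ℝ) + 1 = N := by
          rw [min_eq_right hc.le, Nat.cast_sub (by omega), Nat.cast_one]; ring
        rw [hmin]
        nlinarith
  -- distinct grid boxes meet in a null set
  have hnull : ∀ κ κ', κ ≠ κ' → volume (box κ ∩ box κ') = 0 := by
    intro κ κ' hne
    obtain ⟨i, hi_ne⟩ := Function.ne_iff.1 hne
    have hset : box κ ∩ box κ' = Set.Icc (fun j => max ((lo κ j : ℚ) : ℝ) ((lo κ' j : ℚ) : ℝ))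
        (fun j => min ((hi κ j : ℚ) : ℝ) ((hi κ' j : ℚ) : ℝ)) := by
      ext x
      simp only [box, Set.mem_inter_iff, Set.mem_univ_pi, Set.mem_Icc, Pi.le_def, max_le_iff, le_min_iff]
      constructor
      · rintro ⟨h1, h2⟩; exact ⟨fun j => ⟨(h1 j).1, (h2 j).1⟩, fun j => ⟨(h1 j).2, (h2 j).2⟩⟩
      · rintro ⟨h1, h2⟩; exact ⟨fun j => ⟨(h1 j).1, (h2 j).1⟩, fun j => ⟨(h1 j).2, (h2 j).2⟩⟩
    rw [hset, Real.volume_Icc_pi]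
    refine Finset.prod_eq_zero (Finset.mem_univ i) ?_
    rw [ENNReal.ofReal_eq_zero]
    simp only [hlo, hhi]
    have hi_ne' : (κ i : ℕ) ≠ (κ' i : ℕ) := fun h => hi_ne (Fin.ext h)
    rcases Nat.lt_or_gt_of_ne hi_ne' with h | h
    · have h1 : ((κ i : ℕ) : ℝ) + 1 ≤ (κ' i : ℕ) := by exact_mod_cast h
      have h2 : (((κ i : ℕ) : ℝ) + 1) / N ≤ ((κ' i : ℕ) : ℝ) / N := div_le_div_of_nonneg_right h1 hNpos.le
      linarith [min_le_left ((((κ i : ℕ) : ℝ) + 1) / N) ((((κ' i : ℕ) : ℝ) + 1) / N),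
        le_max_right (((κ i : ℕ) : ℝ) / N) (((κ' i : ℕ) : ℝ) / N)]
    · have h1 : ((κ' i : ℕ) : ℝ) + 1 ≤ (κ i : ℕ) := by exact_mod_cast h
      have h2 : (((κ' i : ℕ) : ℝ) + 1) / N ≤ ((κ i : ℕ) : ℝ) / N := div_le_div_of_nonneg_right h1 hNpos.le
      linarith [min_le_right ((((κ i : ℕ) : ℝ) + 1) / N) ((((κ' i : ℕ) : ℝ) + 1) / N),
        le_max_left (((κ i : ℕ) : ℝ) / N) (((κ' i : ℕ) : ℝ) / N)]
  -- the pieces: restrictions of `s` to the grid boxes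
  have hbox_dom : ∀ κ, box κ ⊆ s.domain := fun κ => by rw [hsd]; exact hbox_cube κ
  let piece : (Fin n → Fin N) → IntegralRep n := fun κ =>
    s.restrict (box κ) (isSemialgebraic_ratBox (lo κ) (hi κ)) (hbox_dom κ)
  have hsum : of s - ∑ κ, of (piece κ) ∈ relations := by
    refine of_sub_sum_of_mem_relations (Finset.univ : Finset (Fin n → Fin N)) s piece ?_ ?_ ?_ ?_
    · intro κ _
      rw [Set.sdiff_eq_empty.2 (show (piece κ).domain ⊆ s.domain from hbox_dom κ), measure_empty]
    · intro κ _ z _; rfl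
    · rw [Set.sdiff_eq_empty.2 ?_, measure_empty]
      intro x hx
      rw [hsd] at hx
      obtain ⟨κ, hκ⟩ := hcover x hx
      exact Set.mem_iUnion₂.2 ⟨κ, Finset.mem_univ κ, hκ⟩
    · intro κ _ κ' _ hne
      exact hnull κ κ' hne
  -- the isolating rationals per box
  let x0 : (Fin n → Fin N) → Fin n → ℝ := fun κ i => ((lo κ i : ℚ) : ℝ)
  have hx0 : ∀ κ, x0 κ ∈ box κ := by
    intro κ
    rw [Set.mem_univ_pi]
    intro i
    refine ⟨le_rfl, ?_⟩
    show ((lo κ i : ℚ) : ℝ) ≤ ((hi κ i : ℚ) : ℝ)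
    exact_mod_cast (hlohi κ i).le
  have ha : ∀ κ : Fin n → Fin N, ∃ a : ℚ, g (x0 κ) - 3 * δ / 8 < a ∧ (a : ℝ) < g (x0 κ) - δ / 4 :=
    fun κ => exists_rat_btwn (by linarith)
  choose a ha1 ha2 using ha
  have hb : ∀ κ : Fin n → Fin N, ∃ b : ℚ, g (x0 κ) + δ / 4 < b ∧ (b : ℝ) < g (x0 κ) + 3 * δ / 8 :=
    fun κ => exists_rat_btwn (by linarith)
  choose b hb1 hb2 using hb
  obtain ⟨ε, hε1, hε2⟩ := exists_rat_btwn (show (0:ℝ) < δ / 8 by positivity)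
  obtain ⟨c, hc1, hc2⟩ := exists_rat_btwn (show δ / 8 < δ / 4 by linarith)
  have hIso : ∀ κ, (a κ < b κ ∧ 0 < ε ∧ ε < c ∧ (∀ x ∈ box κ, ((a κ : ℚ) : ℝ) + ((ε : ℚ) : ℝ) < g x ∧ g x + ((ε : ℚ) : ℝ) < ((b κ : ℚ) : ℝ)) ∧ (∀ x ∈ box κ, ∀ z : ℂ, ((a κ : ℚ) : ℝ) ≤ z.re → z.re ≤ ((b κ : ℚ) : ℝ) → |z.im| ≤ ((c : ℚ) : ℝ) → aeval (Fin.snoc (fun i => ((x i : ℝ) : ℂ)) z : Fin (n + 1) → ℂ) F = 0 → z = ((g x : ℝ) : ℂ))) := by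
    intro κ
    refine ⟨?_, ?_, ?_, ?_, ?_⟩
    · have h : ((a κ : ℚ) : ℝ) < b κ := by linarith [ha2 κ, hb1 κ]
      exact_mod_cast h
    · exact_mod_cast hε1
    · have h : ((ε : ℚ) : ℝ) < c := by linarith
      exact_mod_cast h
    · intro x hx
      have h := hosc κ x hx (x0 κ) (hx0 κ)
      rw [abs_lt] at h
      constructor <;> linarith [ha2 κ, hb1 κ, h.1, h.2]
    · intro x hx z hre1 hre2 him hz0
      by_contra hne
      have h := hosc κ x hx (x0 κ) (hx0 κ)
      rw [abs_lt] at h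
      have hnorm : ‖z - ((g x : ℝ) : ℂ)‖ ≤ δ := by
        refine (Complex.norm_le_abs_re_add_abs_im _).trans ?_
        simp only [Complex.sub_re, Complex.ofReal_re, Complex.sub_im, Complex.ofReal_im, sub_zero]
        have h1 : |z.re - g x| ≤ δ / 2 := by
          rw [abs_le]; constructor <;> linarith [ha1 κ, hb2 κ]
        have h2 : |z.im| ≤ δ / 4 := him.trans (by linarith)
        linarith
      exact hiso x (hbox_cube κ hx) z hne hnorm hz0
  -- assemble over `Fin (N ^ n)`
  let e : Fin (N ^ n) ≃ (Fin n → Fin N) := finFunctionFinEquiv.symm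
  have hs' : ∑ j : Fin (N ^ n), of (piece (e j)) = ∑ κ, of (piece κ) :=
    Equiv.sum_comp e (fun κ => of (piece κ))
  refine ⟨N ^ n, fun j => lo (e j), fun j => hi (e j), fun j => piece (e j), fun j => a (e j), fun j => b (e j),
    fun _ => c, fun _ => ε, fun j i => hlohi (e j) i, fun j => rfl, fun j => hbox_cube (e j),
    fun j z hz => hsg z (hbox_cube (e j) hz), ?_, fun j => hIso (e j)⟩
  rw [hs']
  exact hsum

end Summit.KontsevichZagierPeriods.RootDecompRationalCubeDichotomy.Rung27842.SimpleBranch
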